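import Summits.ValiantsHypothesis.ValiantsHypothesis.Theorems.LacunarySymmetroidMatrixDescartesCensusDoorA34InteriorUnfolding
import Summits.ValiantsHypothesis.ValiantsHypothesis.Theorems.LacunarySymmetroidMatrixDescartesCensusDoorA34Lift

/-!
# `MatrixDescartes` census — DOOR A at `(3,4)`: EVERY touching root beside 17 crossings unfolds — first order off the nodes, second order at a
# node, third order at a zero of the pencil; hence under `PosRootLawAt 3 4 18` NO touching det-root is flanked inside an 18-point alternation chain

HONEST FRAMING.  Object-search cell `pub-symmetroid`, engine seat `val-sym-eng-2` (g13); helper row beside the registered strata line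
`Cruxes/DoorA34/Lines/strata.lean` on stmt-ValiantsHypothesis-19980 (`DoorA34 = PosRootLawAt 3 4 18`: OPEN, typed, never asserted here).  Sequel of
…CensusDoorA34InteriorUnfolding (✓ p731045: a touching root `ρ` with `zᵀ·adj F(ρ)·z ≠ 0` unfolds under `S₀ ↦ S₀ + η·zzᵀ`; node law) and …CensusDoorA34NodalTouch
(at a node the perturbed determinant is `c²·(tr(adj E·F(ρ)) + c·det E)`).  Here the second-order coefficient is put to work:

* §1 `le_card_posRoots_cubicFamily_of_touch₂` / `…₃` — sign bookkeeping for a family `g_c` with `g_c(x) = p(x) + c·A₁(x) + c²·A₂(x) + c³·A₃(x)` at finitely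
  many points: if `p` carries a chain of `N + 1` points and touches zero at a flanked `ρ` with `A₁(ρ) = 0`, then `A₂(ρ)` of the sign opposite to `p(a_k)`
  (second order), or `A₂(ρ) = 0 ≠ A₃(ρ)` (third order), gives some `c` with `N + 2 ≤ Z₊(g_c)` (chain surgery `le_card_posRoots_replace_triple` of p731045).
* §2 the pencil family `S₀ ↦ S₀ + c·E`: `eval_pencil_perturb_letter0`, `eval_det_pencil_perturb_letter0` (tree `det_add_smul_fin_three` at the evaluated matrix:
  `A₁ = x^{d₀}·tr(adj F(x)·E)`, `A₂ = x^{2d₀}·tr(adj E·F(x))`, `A₃ = x^{3d₀}·det E`).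
* §3 the directions are those of the tree's A′ BRIDGE (…CensusDoorA34Lift, `exists_nineteen_of_eighteen_of_countP`: a double-root EIGHTEEN splits
  into a nineteen, three orders): `exists_diag_ne_zero_of_adjugate_eq_zero` and `trace_adjugate_diagonal_three_mul` (`tr(adj E·A) = w·A_ii` for the
  diagonal direction), so at a node with `F(ρ) ≠ 0` both signs of the second-order coefficient occur; at `F(ρ) = 0` the identity direction works.
  PRIOR ART, stated plainly: for `N = 17` on the full support the conclusion of §4 is the A′ bridge's (18 distinct + 19 with multiplicity ⇒ 19); what
  this file adds is the CHAIN-CURRENCY form for EVERY chain length `N` (input = an alternation chain + a flanked touching zero, no Descartes exactness,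
  no multiplicity count), which is what the SHEET needs (§5: 16 crossings + any double root on `det S₃ = 0` ⇒ 18 ON THE SHEET — the null-top stub's
  A′ bridge, not in the tree before).
* §4 `card_posRoots_perturb_ge_of_touch_any` (any `N`) / `nineteen_of_chain_touch_any` — a real SYMMETRIC `(3,4)` pencil whose determinant carries an
  alternation chain of `N + 1` positive points and TOUCHES zero at a flanked `ρ` admits a symmetric perturbation of its bottom letter, `S₀ + c·E`, with
  `≥ N + 2` distinct positive det-roots — no hypothesis on `adj F(ρ)` (cases: `adj F(ρ) ≠ 0` → p731045; node with `F(ρ) ≠ 0` → second order; `F(ρ) = 0` →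
  third order); `no_touch_of_posRootLawAt` (= the A′ bridge's door reading `countP_le_18_of_posRootLawOn` in chain currency).  §5 ★ the SHEET twin
  `eighteen_on_sheet_of_chain_touch_any` (`S₃` untouched: 16 crossings + any touch on the null-top sheet ⇒ 18 on the sheet).

Reading: under `DoorA34` the merge part of the boundary of the (empty) set of symmetric nineteens carries NO 17-crossing configuration (the A′ bridge); the
node law of p731045 records the ORDER at which a would-be merge reopens (1 off the nodes, 2 at a node, 3 at a zero); the sheet stub inherits the same
bridge one level down (§5).  LOCATED (report HOME/DOOR-A34-ENG2G13-REPORT.md): the rail pseudo-nineteens realise their top root inside a near-rank-one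
window next to a real node of the symmetroid lying within ≤ 5 % of the curve — pressure toward exactly the forbidden configuration.  Nothing here bounds any
count; `DoorA34` and all three stubs stay OPEN; registers unchanged (`ζ_sym(3,4) ∈ {18,19}`); nothing on `MatrixDescartes` (stmt-ValiantsHypothesis-18050) or
`VP ≠ VNP` — VP≠VNP not moved.  [folklore] Intermediate value theorem via sign chains (tree `AltChain`), `det(A + cT)` cubic expansion (tree), elementary algebra.
-/

-- `Summit.ValiantsHypothesis.ValiantsHypothesis.…` repeats a component by the D-0017 layout
-- (single-conjunct summit), which the `dupNamespace` linter flags; the name is mandated.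
set_option linter.dupNamespace false

namespace Summit.ValiantsHypothesis.ValiantsHypothesis.Theorems.LacunarySymmetroidMatrixDescartes.Census

open Polynomial Finset
open scoped BigOperators Polynomial Matrix
open Summit.ValiantsHypothesis.ValiantsHypothesis.Theorems.MatrixDescartes.Negative (PosRootLawAt)

/-! ## §1 Sign bookkeeping for a cubic family at finitely many points -/

/-- the common smallness construction: a positive `δ ≤ 1` below `|p(x)|/(|A₁ x| + |A₂ x| + |A₃ x| + 1)` on a finite point set and below one extra bound.
[folklore] -/
theorem exists_small_delta (P : Finset ℝ) (hP : P.Nonempty) (p : ℝ[X]) (A₁ A₂ A₃ : ℝ → ℝ) (hpne : ∀ x ∈ P, p.eval x ≠ 0) (b : ℝ) (hb : 0 < b) :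
    ∃ δ : ℝ, 0 < δ ∧ δ ≤ 1 ∧ δ < b ∧
      ∀ x ∈ P, ∀ c : ℝ, |c| ≤ δ → |c * A₁ x + c ^ 2 * A₂ x + c ^ 3 * A₃ x| < |p.eval x| := by
  classical
  set bound : ℝ → ℝ := fun x => |p.eval x| / (|A₁ x| + |A₂ x| + |A₃ x| + 1) with hbound
  have hbpos : ∀ x ∈ P, 0 < bound x := fun x hx => div_pos (abs_pos.mpr (hpne x hx)) (by positivity)
  obtain ⟨ε, hε, hεle⟩ : ∃ ε : ℝ, 0 < ε ∧ ∀ x ∈ P, ε ≤ bound x := by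
    refine ⟨(P.image bound).min' (hP.image bound), ?_, fun x hx => Finset.min'_le _ _ (Finset.mem_image_of_mem bound hx)⟩
    obtain ⟨x, hx, hfx⟩ := Finset.mem_image.mp (Finset.min'_mem (P.image bound) (hP.image bound))
    rw [← hfx]; exact hbpos x hx
  refine ⟨min (min (1 / 2) (ε / 2)) (b / 2), by positivity, ?_, ?_, ?_⟩
  · exact (min_le_left _ _).trans ((min_le_left _ _).trans (by norm_num))
  · exact (min_le_right _ _).trans_lt (by linarith)
  · intro x hx c hc
    have hc1 : |c| ≤ 1 := hc.trans ((min_le_left _ _).trans ((min_le_left _ _).trans (by norm_num)))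
    have hcε : |c| < ε := lt_of_le_of_lt hc ((min_le_left _ _).trans_lt ((min_le_right _ _).trans_lt (by linarith)))
    have hden : 0 < |A₁ x| + |A₂ x| + |A₃ x| + 1 := by positivity
    have hpx : ε * (|A₁ x| + |A₂ x| + |A₃ x| + 1) ≤ |p.eval x| := (le_div_iff₀ hden).mp (hεle x hx)
    have h2 : |c| ^ 2 ≤ |c| := by nlinarith [abs_nonneg c]
    have h3 : |c| ^ 3 ≤ |c| := by nlinarith [abs_nonneg c]
    calc |c * A₁ x + c ^ 2 * A₂ x + c ^ 3 * A₃ x|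
        ≤ |c * A₁ x| + |c ^ 2 * A₂ x| + |c ^ 3 * A₃ x| := abs_add_three _ _ _
      _ = |c| * |A₁ x| + |c| ^ 2 * |A₂ x| + |c| ^ 3 * |A₃ x| := by rw [abs_mul, abs_mul, abs_mul, abs_pow, abs_pow]
      _ ≤ |c| * |A₁ x| + |c| * |A₂ x| + |c| * |A₃ x| := by
          nlinarith [abs_nonneg (A₂ x), abs_nonneg (A₃ x)]
      _ = |c| * (|A₁ x| + |A₂ x| + |A₃ x|) := by ring
      _ < ε * (|A₁ x| + |A₂ x| + |A₃ x| + 1) := by nlinarith [abs_nonneg (A₁ x), abs_nonneg (A₂ x), abs_nonneg (A₃ x), abs_nonneg c]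
      _ ≤ |p.eval x| := hpx

/-- **Second-order unfolding of a touch.**  `p` carries a chain of `N + 1` points and touches zero at a flanked `ρ`; `g_c(x) = p(x) + cA₁(x) + c²A₂(x) + c³A₃(x)`
pointwise; `A₁(ρ) = 0` and `A₂(ρ)` has the sign opposite to `p(a_k)`.  Then some `g_c` has `≥ N + 2` distinct positive roots. [folklore] -/
theorem le_card_posRoots_cubicFamily_of_touch₂ {p : ℝ[X]} {N : ℕ} {s : ℝ} {a : Fin (N + 1) → ℝ} (h : AltChain p N s a) (k : Fin (N + 1))
    {u ρ v : ℝ} (hu0 : 0 < u) (huρ : u < ρ) (hρv : ρ < v)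
    (hlo : ∀ j : Fin (N + 1), j.val + 1 = k.val → a j < u) (hhi : ∀ j : Fin (N + 1), j.val = k.val + 1 → v < a j)
    (hpu : 0 < p.eval (a k) * p.eval u) (hpρ : p.eval ρ = 0) (hpv : 0 < p.eval (a k) * p.eval v)
    (g : ℝ → ℝ[X]) (A₁ A₂ A₃ : ℝ → ℝ) (hg : ∀ c x, (g c).eval x = p.eval x + c * A₁ x + c ^ 2 * A₂ x + c ^ 3 * A₃ x)
    (h1 : A₁ ρ = 0) (h2 : A₂ ρ * p.eval (a k) < 0) :
    ∃ c : ℝ, N + 2 ≤ ((g c).roots.toFinset.filter (fun t => 0 < t)).card := by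
  classical
  set P : Finset ℝ := (Finset.univ.image a) ∪ {u, v} with hP
  have hpak : p.eval (a k) ≠ 0 := le_card_posRoots_add_C_mul_of_touch.altChain_eval_ne_zero' h k
  have hpne : ∀ x ∈ P, p.eval x ≠ 0 := by
    intro x hx
    rcases Finset.mem_union.mp hx with hx | hx
    · obtain ⟨j, -, rfl⟩ := Finset.mem_image.mp hx
      exact le_card_posRoots_add_C_mul_of_touch.altChain_eval_ne_zero' h j
    · rcases Finset.mem_insert.mp hx with rfl | hx
      · intro h0; rw [h0, mul_zero] at hpu; exact lt_irrefl _ hpu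
      · rw [Finset.mem_singleton] at hx; subst hx
        intro h0; rw [h0, mul_zero] at hpv; exact lt_irrefl _ hpv
  have hA2 : A₂ ρ ≠ 0 := by intro h0; rw [h0, zero_mul] at h2; exact lt_irrefl _ h2
  obtain ⟨δ, hδ, hδ1, hδb, hsmall⟩ :=
    exists_small_delta P ⟨u, by simp [hP]⟩ p A₁ A₂ A₃ hpne (|A₂ ρ| / (|A₃ ρ| + 1)) (div_pos (abs_pos.mpr hA2) (by positivity))
  refine ⟨δ, ?_⟩
  have hkeep : ∀ x ∈ P, 0 < p.eval x * (g δ).eval x := by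
    intro x hx
    have := mul_add_pos_of_abs_lt (hsmall x hx δ (by rw [abs_of_pos hδ]))
    rw [hg]; convert this using 2; ring
  refine le_card_posRoots_replace_triple h k hu0 huρ hρv hlo hhi (fun j _ => hkeep _ (by simp [hP])) ?_ ?_ ?_
  · exact le_card_posRoots_add_C_mul_of_touch.pos_of_mul_pos_both (hkeep u (by simp [hP])) hpu hpak
  · rw [hg, hpρ, h1]
    -- `p(a_k)·(δ²A₂ + δ³A₃) < 0` because `|δ A₃| < |A₂|`
    have hd3 : |δ * A₃ ρ| < |A₂ ρ| := by
      rw [abs_mul, abs_of_pos hδ]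
      have hden : 0 < |A₃ ρ| + 1 := by positivity
      have := (lt_div_iff₀ hden).mp hδb
      nlinarith [abs_nonneg (A₃ ρ)]
    have hsame : 0 < A₂ ρ * (A₂ ρ + δ * A₃ ρ) := mul_add_pos_of_abs_lt hd3
    have : p.eval (a k) * (0 + δ * 0 + δ ^ 2 * A₂ ρ + δ ^ 3 * A₃ ρ) = δ ^ 2 * (p.eval (a k) * (A₂ ρ + δ * A₃ ρ)) := by ring
    rw [this]
    have hneg : p.eval (a k) * (A₂ ρ + δ * A₃ ρ) < 0 := by
      have e1 : (A₂ ρ * p.eval (a k)) * (A₂ ρ * (A₂ ρ + δ * A₃ ρ)) < 0 := mul_neg_of_neg_of_pos h2 hsame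
      have e2 : (A₂ ρ * p.eval (a k)) * (A₂ ρ * (A₂ ρ + δ * A₃ ρ)) = A₂ ρ ^ 2 * (p.eval (a k) * (A₂ ρ + δ * A₃ ρ)) := by ring
      rw [e2] at e1
      by_contra hc
      exact absurd e1 (not_lt.mpr (mul_nonneg (sq_nonneg _) (not_lt.mp hc)))
    exact mul_neg_of_pos_of_neg (by positivity) hneg
  · exact le_card_posRoots_add_C_mul_of_touch.pos_of_mul_pos_both (hkeep v (by simp [hP])) hpv hpak

/-- **Third-order unfolding of a touch**: as before with `A₁(ρ) = A₂(ρ) = 0` and `A₃(ρ) ≠ 0` (the sign of `c` does the steering). [folklore] -/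
theorem le_card_posRoots_cubicFamily_of_touch₃ {p : ℝ[X]} {N : ℕ} {s : ℝ} {a : Fin (N + 1) → ℝ} (h : AltChain p N s a) (k : Fin (N + 1))
    {u ρ v : ℝ} (hu0 : 0 < u) (huρ : u < ρ) (hρv : ρ < v)
    (hlo : ∀ j : Fin (N + 1), j.val + 1 = k.val → a j < u) (hhi : ∀ j : Fin (N + 1), j.val = k.val + 1 → v < a j)
    (hpu : 0 < p.eval (a k) * p.eval u) (hpρ : p.eval ρ = 0) (hpv : 0 < p.eval (a k) * p.eval v)
    (g : ℝ → ℝ[X]) (A₁ A₂ A₃ : ℝ → ℝ) (hg : ∀ c x, (g c).eval x = p.eval x + c * A₁ x + c ^ 2 * A₂ x + c ^ 3 * A₃ x)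
    (h1 : A₁ ρ = 0) (h2 : A₂ ρ = 0) (h3 : A₃ ρ ≠ 0) :
    ∃ c : ℝ, N + 2 ≤ ((g c).roots.toFinset.filter (fun t => 0 < t)).card := by
  classical
  set P : Finset ℝ := (Finset.univ.image a) ∪ {u, v} with hP
  have hpak : p.eval (a k) ≠ 0 := le_card_posRoots_add_C_mul_of_touch.altChain_eval_ne_zero' h k
  have hpne : ∀ x ∈ P, p.eval x ≠ 0 := by
    intro x hx
    rcases Finset.mem_union.mp hx with hx | hx
    · obtain ⟨j, -, rfl⟩ := Finset.mem_image.mp hx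
      exact le_card_posRoots_add_C_mul_of_touch.altChain_eval_ne_zero' h j
    · rcases Finset.mem_insert.mp hx with rfl | hx
      · intro h0; rw [h0, mul_zero] at hpu; exact lt_irrefl _ hpu
      · rw [Finset.mem_singleton] at hx; subst hx
        intro h0; rw [h0, mul_zero] at hpv; exact lt_irrefl _ hpv
  obtain ⟨δ, hδ, hδ1, -, hsmall⟩ := exists_small_delta P ⟨u, by simp [hP]⟩ p A₁ A₂ A₃ hpne 1 one_pos
  -- sign of `c`: opposite to `p(a_k)·A₃(ρ)`
  set σ : ℝ := if 0 < p.eval (a k) * A₃ ρ then -1 else 1 with hσ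
  have hσabs : |σ| = 1 := by rw [hσ]; split_ifs <;> simp
  have hσsign : σ * (p.eval (a k) * A₃ ρ) < 0 := by
    rw [hσ]; split_ifs with hq
    · linarith
    · have : p.eval (a k) * A₃ ρ < 0 := lt_of_le_of_ne (not_lt.mp hq) (mul_ne_zero hpak h3)
      linarith
  refine ⟨σ * δ, ?_⟩
  have hcabs : |σ * δ| ≤ δ := by rw [abs_mul, hσabs, one_mul, abs_of_pos hδ]
  have hkeep : ∀ x ∈ P, 0 < p.eval x * (g (σ * δ)).eval x := by
    intro x hx
    have := mul_add_pos_of_abs_lt (hsmall x hx (σ * δ) hcabs)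
    rw [hg]; convert this using 2; ring
  refine le_card_posRoots_replace_triple h k hu0 huρ hρv hlo hhi (fun j _ => hkeep _ (by simp [hP])) ?_ ?_ ?_
  · exact le_card_posRoots_add_C_mul_of_touch.pos_of_mul_pos_both (hkeep u (by simp [hP])) hpu hpak
  · rw [hg, hpρ, h1, h2]
    have hσ3 : σ ^ 3 = σ := by rw [hσ]; split_ifs <;> norm_num
    have : p.eval (a k) * (0 + σ * δ * 0 + (σ * δ) ^ 2 * 0 + (σ * δ) ^ 3 * A₃ ρ) = δ ^ 3 * (σ ^ 3 * (p.eval (a k) * A₃ ρ)) := by ring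
    rw [this, hσ3]
    exact mul_neg_of_pos_of_neg (by positivity) hσsign
  · exact le_card_posRoots_add_C_mul_of_touch.pos_of_mul_pos_both (hkeep v (by simp [hP])) hpv hpak

/-! ## §2 The pencil family `S₀ ↦ S₀ + c·E` -/

/-- evaluating the perturbed pencil: `Σ x^{d_l}(S_l + [l = 0]·c·E) = F(x) + (c·x^{d₀})·E`. [folklore] -/
theorem eval_pencil_perturb_letter0 (d : Fin 4 → ℕ) (S : Fin 4 → Matrix (Fin 3) (Fin 3) ℝ) (E : Matrix (Fin 3) (Fin 3) ℝ) (c x : ℝ) :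
    (∑ l, x ^ d l • (S l + if l = 0 then c • E else 0)) = (∑ l, x ^ d l • S l) + (c * x ^ d 0) • E := by
  have hsplit : ∀ l : Fin 4, x ^ d l • (S l + if l = 0 then c • E else 0) = x ^ d l • S l + (if l = 0 then (c * x ^ d 0) • E else 0) := by
    intro l
    split_ifs with hl
    · subst hl; rw [smul_add, smul_smul, mul_comm]
    · rw [add_zero, add_zero]
  simp_rw [hsplit, Finset.sum_add_distrib, Finset.sum_ite_eq', Finset.mem_univ, if_true]

/-- **the cubic family of the bottom-letter perturbation**: the determinant of the pencil with `S₀ + c·E`, at a positive point `x`, equals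
`p(x) + c·A₁(x) + c²·A₂(x) + c³·A₃(x)` with `A₁ = x^{d₀}·tr(adj F(x)·E)`, `A₂ = x^{2d₀}·tr(adj E·F(x))`, `A₃ = x^{3d₀}·det E`. [folklore] -/
theorem eval_det_pencil_perturb_letter0 (d : Fin 4 → ℕ) (S : Fin 4 → Matrix (Fin 3) (Fin 3) ℝ) (E : Matrix (Fin 3) (Fin 3) ℝ) (c x : ℝ) :
    ((∑ l, (X : ℝ[X]) ^ d l • (S l + if l = 0 then c • E else 0).map C).det).eval x
      = ((∑ l, (X : ℝ[X]) ^ d l • (S l).map C).det).eval x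
        + c * (x ^ d 0 * ((∑ l, x ^ d l • S l).adjugate * E).trace)
        + c ^ 2 * (x ^ (2 * d 0) * (E.adjugate * (∑ l, x ^ d l • S l)).trace)
        + c ^ 3 * (x ^ (3 * d 0) * E.det) := by
  rw [SymmetroidDescartes.eval_det_pencil, SymmetroidDescartes.eval_det_pencil, eval_pencil_perturb_letter0, det_add_smul_fin_three]
  ring

/-! ## §3 Directions: at a node with `F(ρ) ≠ 0` the second-order coefficient takes both signs -/

/-! ## §4 Every touching root beside 17 crossings unfolds -/

/-- the symmetric letters of a real point of the pencil. [folklore] -/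
theorem isSymm_eval_pencil (d : Fin 4 → ℕ) {S : Fin 4 → Matrix (Fin 3) (Fin 3) ℝ} (hS : ∀ l, (S l).IsSymm) (ρ : ℝ) :
    (∑ l, ρ ^ d l • S l).IsSymm := by
  unfold Matrix.IsSymm
  rw [Matrix.transpose_sum]
  exact Finset.sum_congr rfl fun l _ => by rw [Matrix.transpose_smul, (hS l).eq]

/-- the perturbed letters stay symmetric for a symmetric direction. [folklore] -/
theorem perturb_letter0_isSymm (S : Fin 4 → Matrix (Fin 3) (Fin 3) ℝ) (hS : ∀ l, (S l).IsSymm) {E : Matrix (Fin 3) (Fin 3) ℝ} (hE : E.IsSymm)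
    (c : ℝ) (l : Fin 4) : (S l + if l = 0 then c • E else 0).IsSymm := by
  split_ifs
  · exact (hS l).add (hE.smul c)
  · rw [add_zero]; exact hS l

/-- ★★★ **EVERY TOUCHING ROOT BESIDE AN 18-POINT CHAIN UNFOLDS.**  A real symmetric `(3,4)` pencil whose determinant carries an alternation chain of `N + 1`
positive points and touches zero at a flanked `ρ` (no hypothesis on `adj F(ρ)`) admits a SYMMETRIC perturbation of its bottom letter, `S₀ + c·E`, whose
determinant has `≥ N + 2` distinct positive roots.  Off the nodes this is p731045 (first order, `E = zzᵀ`); at a node with `F(ρ) ≠ 0` the second-order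
coefficient `ρ^{2d₀}·tr(adj E·F(ρ)) = ±ρ^{2d₀}·F(ρ)_kk` is steered by §3; at `F(ρ) = 0` the identity direction works at third order. [folklore] -/
theorem card_posRoots_perturb_ge_of_touch_any (d : Fin 4 → ℕ) (S : Fin 4 → Matrix (Fin 3) (Fin 3) ℝ) (hS : ∀ l, (S l).IsSymm)
    {N : ℕ} {s : ℝ} {a : Fin (N + 1) → ℝ} (h : AltChain ((∑ l, (X : ℝ[X]) ^ d l • (S l).map C).det) N s a) (k : Fin (N + 1))
    {u ρ v : ℝ} (hu0 : 0 < u) (huρ : u < ρ) (hρv : ρ < v)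
    (hlo : ∀ j : Fin (N + 1), j.val + 1 = k.val → a j < u) (hhi : ∀ j : Fin (N + 1), j.val = k.val + 1 → v < a j)
    (hpu : 0 < (∑ l, (a k) ^ d l • S l).det * (∑ l, u ^ d l • S l).det)
    (hpρ : (∑ l, ρ ^ d l • S l).det = 0)
    (hpv : 0 < (∑ l, (a k) ^ d l • S l).det * (∑ l, v ^ d l • S l).det) :
    ∃ E : Matrix (Fin 3) (Fin 3) ℝ, E.IsSymm ∧ ∃ c : ℝ, N + 2 ≤ ((((∑ l, (X : ℝ[X]) ^ d l •
      ((S l + if l = 0 then c • E else 0)).map C)).det).roots.toFinset.filter (fun t => 0 < t)).card := by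
  set F : Matrix (Fin 3) (Fin 3) ℝ := ∑ l, ρ ^ d l • S l with hF
  set p : ℝ[X] := (∑ l, (X : ℝ[X]) ^ d l • (S l).map C).det with hp
  have hev : ∀ t : ℝ, p.eval t = (∑ l, t ^ d l • S l).det := fun t => SymmetroidDescartes.eval_det_pencil S d t
  have hρ0 : 0 < ρ := hu0.trans huρ
  by_cases hadj : F.adjugate = 0
  · by_cases hF0 : F = 0
    · -- third order along the identity
      refine ⟨1, Matrix.isSymm_one, ?_⟩
      refine le_card_posRoots_cubicFamily_of_touch₃ h k hu0 huρ hρv hlo hhi (by rwa [hev, hev]) (by rw [hev, ← hF, hpρ]) (by rwa [hev, hev])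
        (fun c => (∑ l, (X : ℝ[X]) ^ d l • (S l + if l = 0 then c • (1 : Matrix (Fin 3) (Fin 3) ℝ) else 0).map C).det)
        (fun x => x ^ d 0 * ((∑ l, x ^ d l • S l).adjugate * 1).trace)
        (fun x => x ^ (2 * d 0) * ((1 : Matrix (Fin 3) (Fin 3) ℝ).adjugate * (∑ l, x ^ d l • S l)).trace)
        (fun x => x ^ (3 * d 0) * (1 : Matrix (Fin 3) (Fin 3) ℝ).det)
        (fun c x => by rw [eval_det_pencil_perturb_letter0, hp]) ?_ ?_ ?_
      · show ρ ^ d 0 * ((∑ l, ρ ^ d l • S l).adjugate * 1).trace = 0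
        rw [← hF, hadj, Matrix.zero_mul, Matrix.trace_zero, mul_zero]
      · show ρ ^ (2 * d 0) * ((1 : Matrix (Fin 3) (Fin 3) ℝ).adjugate * ∑ l, ρ ^ d l • S l).trace = 0
        rw [← hF, hF0, Matrix.mul_zero, Matrix.trace_zero, mul_zero]
      · show ρ ^ (3 * d 0) * (1 : Matrix (Fin 3) (Fin 3) ℝ).det ≠ 0
        rw [Matrix.det_one, mul_one]; exact pow_ne_zero _ hρ0.ne'
    · -- second order at a node: pick a diagonal entry and the matching direction
      obtain ⟨kk, hkk⟩ := exists_diag_ne_zero_of_adjugate_eq_zero (isSymm_eval_pencil d hS ρ) hadj hF0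
      set σ : ℝ := -((∑ l, (a k) ^ d l • S l).det * F kk kk) with hσ
      -- the A′-bridge direction of …CensusDoorA34Lift: `diag(0 at kk, 1 at kk+1, σ at kk+2)`, `tr(adj E·F) = σ·F kk kk`
      set E : Matrix (Fin 3) (Fin 3) ℝ := Matrix.diagonal fun m : Fin 3 => if m = kk then (0 : ℝ) else if m = kk + 1 then 1 else σ with hEdef
      have hE : E.IsSymm := Matrix.isSymm_diagonal _
      have htr : (E.adjugate * F).trace = σ * F kk kk := trace_adjugate_diagonal_three_mul kk σ F
      refine ⟨E, hE, ?_⟩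
      refine le_card_posRoots_cubicFamily_of_touch₂ h k hu0 huρ hρv hlo hhi (by rwa [hev, hev]) (by rw [hev, ← hF, hpρ]) (by rwa [hev, hev])
        (fun c => (∑ l, (X : ℝ[X]) ^ d l • (S l + if l = 0 then c • E else 0).map C).det)
        (fun x => x ^ d 0 * ((∑ l, x ^ d l • S l).adjugate * E).trace)
        (fun x => x ^ (2 * d 0) * (E.adjugate * (∑ l, x ^ d l • S l)).trace)
        (fun x => x ^ (3 * d 0) * E.det)
        (fun c x => by rw [eval_det_pencil_perturb_letter0, hp]) ?_ ?_
      · show ρ ^ d 0 * ((∑ l, ρ ^ d l • S l).adjugate * E).trace = 0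
        rw [← hF, hadj, Matrix.zero_mul, Matrix.trace_zero, mul_zero]
      · show ρ ^ (2 * d 0) * (E.adjugate * ∑ l, ρ ^ d l • S l).trace * p.eval (a k) < 0
        rw [← hF, htr, hev, hσ]
        have h1 : 0 < ρ ^ (2 * d 0) := pow_pos hρ0 _
        have hP : (∑ l, a k ^ d l • S l).det ≠ 0 := by
          rw [← hev]; exact le_card_posRoots_add_C_mul_of_touch.altChain_eval_ne_zero' h k
        have h2 : 0 < ((∑ l, a k ^ d l • S l).det * F kk kk) * ((∑ l, a k ^ d l • S l).det * F kk kk) :=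
          mul_self_pos.mpr (mul_ne_zero hP hkk)
        have e : ρ ^ (2 * d 0) * (-((∑ l, a k ^ d l • S l).det * F kk kk) * F kk kk) * (∑ l, a k ^ d l • S l).det
            = -(ρ ^ (2 * d 0) * (((∑ l, a k ^ d l • S l).det * F kk kk) * ((∑ l, a k ^ d l • S l).det * F kk kk))) := by ring
        rw [e]
        exact neg_neg_of_pos (mul_pos h1 h2)
  · -- first order off the node (p731045)
    have hz : ∃ z : Fin 3 → ℝ, z ⬝ᵥ (F.adjugate *ᵥ z) ≠ 0 := by
      by_contra hcon
      push Not at hcon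
      exact hadj (eq_zero_of_isSymm_of_quadForm_eq_zero _ (isSymm_adjugate_eval_pencil d hS ρ) hcon)
    obtain ⟨z, hz⟩ := hz
    obtain ⟨η, hη⟩ := card_posRoots_perturb_ge_of_touch d S h k hu0 huρ hρv hlo hhi hpu hpρ hpv z hz
    refine ⟨Matrix.vecMulVec z z, ?_, η, hη⟩
    unfold Matrix.IsSymm; ext i j; simp [Matrix.vecMulVec_apply, mul_comm]

/-- ★★★ **NINETEEN FROM «17 CROSSINGS + ANY TOUCH».**  The `N = 17` instance: an 18-point alternation chain plus one flanked touching zero of the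
determinant of a real symmetric `(3,4)` pencil yields, after a symmetric perturbation of the bottom letter, `≥ 19` distinct positive det-roots. [folklore] -/
theorem nineteen_of_chain_touch_any (d : Fin 4 → ℕ) (S : Fin 4 → Matrix (Fin 3) (Fin 3) ℝ) (hS : ∀ l, (S l).IsSymm)
    {s : ℝ} {a : Fin 18 → ℝ} (h : AltChain ((∑ l, (X : ℝ[X]) ^ d l • (S l).map C).det) 17 s a) (k : Fin 18)
    {u ρ v : ℝ} (hu0 : 0 < u) (huρ : u < ρ) (hρv : ρ < v)
    (hlo : ∀ j : Fin 18, j.val + 1 = k.val → a j < u) (hhi : ∀ j : Fin 18, j.val = k.val + 1 → v < a j)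
    (hpu : 0 < (∑ l, (a k) ^ d l • S l).det * (∑ l, u ^ d l • S l).det) (hpρ : (∑ l, ρ ^ d l • S l).det = 0)
    (hpv : 0 < (∑ l, (a k) ^ d l • S l).det * (∑ l, v ^ d l • S l).det) :
    ∃ E : Matrix (Fin 3) (Fin 3) ℝ, E.IsSymm ∧ ∃ c : ℝ, 19 ≤ ((((∑ l, (X : ℝ[X]) ^ d l •
      ((S l + if l = 0 then c • E else 0)).map C)).det).roots.toFinset.filter (fun t => 0 < t)).card :=
  card_posRoots_perturb_ge_of_touch_any d S hS h k hu0 huρ hρv hlo hhi hpu hpρ hpv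

/-- ★★★ **NO TOUCHING ROOT BESIDE 17 CROSSINGS (under `PosRootLawAt 3 4 18 = DoorA34`).**  IF the crux holds, then no real symmetric `(3,4)` pencil
whose determinant carries an alternation chain of 18 positive points has a further flanked touching zero — nodal or not: the merge side of the boundary
of the (then empty) set of symmetric nineteens carries no 17-crossing configuration at all. [folklore] -/
theorem no_touch_of_posRootLawAt (hlaw : PosRootLawAt 3 4 18)
    (d : Fin 4 → ℕ) (S : Fin 4 → Matrix (Fin 3) (Fin 3) ℝ) (hS : ∀ l, (S l).IsSymm)
    {s : ℝ} {a : Fin 18 → ℝ} (h : AltChain ((∑ l, (X : ℝ[X]) ^ d l • (S l).map C).det) 17 s a) (k : Fin 18)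
    {u ρ v : ℝ} (hu0 : 0 < u) (huρ : u < ρ) (hρv : ρ < v)
    (hlo : ∀ j : Fin 18, j.val + 1 = k.val → a j < u) (hhi : ∀ j : Fin 18, j.val = k.val + 1 → v < a j)
    (hpu : 0 < (∑ l, (a k) ^ d l • S l).det * (∑ l, u ^ d l • S l).det) (hpρ : (∑ l, ρ ^ d l • S l).det = 0)
    (hpv : 0 < (∑ l, (a k) ^ d l • S l).det * (∑ l, v ^ d l • S l).det) : False := by
  obtain ⟨E, hE, c, h19⟩ := nineteen_of_chain_touch_any d S hS h k hu0 huρ hρv hlo hhi hpu hpρ hpv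
  have := hlaw d (fun l => S l + if l = 0 then c • E else 0) (perturb_letter0_isSymm S hS hE c)
  omega

/-! ## §5 The sheet twin -/

/-- **ON THE SHEET: 16 crossings + ANY touch ⇒ 18 on the sheet.**  The perturbation leaves `S₃` untouched, so `det S₃ = 0` persists: a null-top pencil whose
determinant carries a 17-point chain plus a flanked touching zero yields a SYMMETRIC pencil ON THE SHEET with `≥ 18` distinct positive det-roots — the
configuration `stub_nullTopCeiling` must exclude, now without any adjugate hypothesis. [folklore] -/
theorem eighteen_on_sheet_of_chain_touch_any (d : Fin 4 → ℕ) (S : Fin 4 → Matrix (Fin 3) (Fin 3) ℝ) (hS : ∀ l, (S l).IsSymm)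
    (h3 : (S 3).det = 0)
    {s : ℝ} {a : Fin 17 → ℝ} (h : AltChain ((∑ l, (X : ℝ[X]) ^ d l • (S l).map C).det) 16 s a) (k : Fin 17)
    {u ρ v : ℝ} (hu0 : 0 < u) (huρ : u < ρ) (hρv : ρ < v)
    (hlo : ∀ j : Fin 17, j.val + 1 = k.val → a j < u) (hhi : ∀ j : Fin 17, j.val = k.val + 1 → v < a j)
    (hpu : 0 < (∑ l, (a k) ^ d l • S l).det * (∑ l, u ^ d l • S l).det) (hpρ : (∑ l, ρ ^ d l • S l).det = 0)
    (hpv : 0 < (∑ l, (a k) ^ d l • S l).det * (∑ l, v ^ d l • S l).det) :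
    ∃ S' : Fin 4 → Matrix (Fin 3) (Fin 3) ℝ, (∀ l, (S' l).IsSymm) ∧ (S' 3).det = 0 ∧
      18 ≤ (((∑ l, (X : ℝ[X]) ^ d l • (S' l).map C).det).roots.toFinset.filter (fun t => 0 < t)).card := by
  obtain ⟨E, hE, c, h18⟩ := card_posRoots_perturb_ge_of_touch_any d S hS h k hu0 huρ hρv hlo hhi hpu hpρ hpv
  refine ⟨fun l => S l + if l = 0 then c • E else 0, perturb_letter0_isSymm S hS hE c, ?_, h18⟩
  show (S 3 + if (3 : Fin 4) = 0 then c • E else 0).det = 0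
  rw [if_neg (by decide), add_zero, h3]

end Summit.ValiantsHypothesis.ValiantsHypothesis.Theorems.LacunarySymmetroidMatrixDescartes.Census
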